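import Literature.NumberTheory.LFunctions.RudnickSarnakSieving
import Mathlib.MeasureTheory.Constructions.Pi
import HarnessLib

/-!
# Coordinates on the strata `H_G = {u : ∑_{i ∈ C} u_i = 0 for every block C of G}`

Rudnick–Sarnak, Duke Math. J. **81** (1996), §4: both sides of Theorem 4.1 are sums, over set
partitions `G` of `N = {1, …, n}`, of integrals of `Φ` over the subspace
`H_G = {u ∈ ℝⁿ : ∑_{i ∈ G_j} u_i = 0 for all blocks G_j}` against explicit densities — the
`δ`-factors `∏_j δ(∑_{i ∈ G_j} u_i)` of (4.13)/(4.19) ("comparing the coefficients of `δ_F(u)`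
in Propositions 4.1 and 4.2", p. 308). This file fixes, once and for all, coordinates on `H_G`:
each block is represented by its least element (`rep`), the remaining indices are *free*
(`Free G`), and `extG G u'` extends free coordinates `u'` to the unique point of `H_G` with these
coordinates (the representative coordinate of each block is minus the sum of the others).
Integrals "over `H_G`" are then integrals over `Free G → ℝ` with Lebesgue measure.

## Contents

* `rep`, `IsRep`, `Free`, `liftFree`, `extG`; `extG_apply_of_not_isRep`, `sum_part_extG`
  (block sums vanish), `extG_eq_of_sum_part_eq_zero` (uniqueness).

## References

* Z. Rudnick, P. Sarnak, Duke Math. J. 81 (1996), (4.13), (4.19), p. 308.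
-/

noncomputable section

open Finset

namespace Literature.NumberTheory.LFunctions

namespace RudnickSarnak

variable {n : ℕ} (G : Finpartition (univ : Finset (Fin n)))

/-! ## Representatives and free indices -/

/-- The representative of the block of `j`: its least element. [folklore] -/
def rep (j : Fin n) : Fin n := (G.part j).min' ⟨j, G.mem_part_self.2 (mem_univ j)⟩

/-- The representative lies in the block. [folklore] -/
theorem rep_mem (j : Fin n) : rep G j ∈ G.part j := Finset.min'_mem _ _

/-- The representative is the least element of the block. [folklore] -/
theorem rep_le {i j : Fin n} (h : i ∈ G.part j) : rep G j ≤ i := Finset.min'_le _ _ h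

/-- Points of the same block have the same representative. [folklore] -/
theorem rep_eq_rep_of_mem {i j : Fin n} (h : i ∈ G.part j) : rep G i = rep G j := by
  have : G.part i = G.part j := G.part_eq_of_mem (G.part_mem.2 (mem_univ j)) h
  unfold rep
  congr 1

/-- The block of the representative is the block. [folklore] -/
theorem part_rep (j : Fin n) : G.part (rep G j) = G.part j :=
  G.part_eq_of_mem (G.part_mem.2 (mem_univ j)) (rep_mem G j)

/-- [folklore] -/
theorem rep_rep (j : Fin n) : rep G (rep G j) = rep G j := rep_eq_rep_of_mem G (rep_mem G j)

/-- `j` is the representative of its block. [folklore] -/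
def IsRep (j : Fin n) : Prop := rep G j = j

/-- Decidability of being a representative. [folklore] -/
instance instDecidablePredIsRep : DecidablePred (IsRep G) :=
  fun j ↦ inferInstanceAs (Decidable (rep G j = j))

/-- [folklore] -/
theorem isRep_rep (j : Fin n) : IsRep G (rep G j) := rep_rep G j

/-- A representative lying in the block of `j` is `rep G j`. [folklore] -/
theorem eq_rep_of_isRep_of_mem {i j : Fin n} (hi : IsRep G i) (h : i ∈ G.part j) : i = rep G j := by
  rw [← rep_eq_rep_of_mem G h]
  exact hi.symm

/-- The free indices: those which are not the representative of their block (RS: the variables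
left after integrating out the `δ(∑_{i ∈ G_j} u_i)`). [cite: RudnickSarnak1996, (4.13)] -/
abbrev Free : Type := {j : Fin n // ¬IsRep G j}

/-! ## Extension of free coordinates to `H_G` -/

/-- Extension of free coordinates by `0` at the representatives. [folklore] -/
def liftFree (u' : Free G → ℝ) (i : Fin n) : ℝ := if h : IsRep G i then 0 else u' ⟨i, h⟩

/-- [folklore] -/
theorem liftFree_apply_of_not_isRep (u' : Free G → ℝ) {i : Fin n} (h : ¬IsRep G i) :
    liftFree G u' i = u' ⟨i, h⟩ := by
  simp [liftFree, h]

/-- [folklore] -/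
theorem liftFree_apply_of_isRep (u' : Free G → ℝ) {i : Fin n} (h : IsRep G i) :
    liftFree G u' i = 0 := by
  simp [liftFree, h]

/-- `extG G u'`: the unique point of `H_G = {u : ∑_{i ∈ C} u_i = 0 for all blocks C}` whose free
coordinates are `u'` (the representative of each block carries minus the sum of the other
coordinates of the block). [cite: RudnickSarnak1996, (4.13)] -/
def extG (u' : Free G → ℝ) (j : Fin n) : ℝ :=
  if IsRep G j then -∑ i ∈ (G.part j).erase j, liftFree G u' i else liftFree G u' j

/-- On free indices `extG` is the given coordinate. [folklore] -/
theorem extG_apply_of_not_isRep (u' : Free G → ℝ) {j : Fin n} (h : ¬IsRep G j) :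
    extG G u' j = u' ⟨j, h⟩ := by
  simp [extG, h, liftFree]

/-- [folklore] -/
theorem extG_apply_free (u' : Free G → ℝ) (j : Free G) : extG G u' j = u' j := by
  rw [extG_apply_of_not_isRep G u' j.2]

/-- At a representative `extG` is minus the sum of the free coordinates of the block. [folklore] -/
theorem extG_apply_of_isRep (u' : Free G → ℝ) {j : Fin n} (h : IsRep G j) :
    extG G u' j = -∑ i ∈ (G.part j).erase j, liftFree G u' i := by
  simp [extG, h]

/-- **Block sums vanish**: `extG G u' ∈ H_G`. [cite: RudnickSarnak1996, (4.13)] -/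
theorem sum_part_extG (u' : Free G → ℝ) (j : Fin n) : ∑ i ∈ G.part j, extG G u' i = 0 := by
  have hr : rep G j ∈ G.part j := rep_mem G j
  rw [← Finset.add_sum_erase _ _ hr, extG_apply_of_isRep G u' (isRep_rep G j), part_rep]
  have : ∀ i ∈ (G.part j).erase (rep G j), extG G u' i = liftFree G u' i := by
    intro i hi
    obtain ⟨hne, hi⟩ := Finset.mem_erase.1 hi
    have hnot : ¬IsRep G i := fun h ↦ hne (eq_rep_of_isRep_of_mem G h hi)
    rw [extG_apply_of_not_isRep G u' hnot, liftFree_apply_of_not_isRep G u' hnot]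
  rw [Finset.sum_congr rfl this, neg_add_cancel]

/-- **Uniqueness**: a point of `H_G` is `extG` of its free coordinates. [folklore] -/
theorem extG_eq_of_sum_part_eq_zero (u : Fin n → ℝ) (hu : ∀ j, ∑ i ∈ G.part j, u i = 0) :
    extG G (fun i : Free G ↦ u i) = u := by
  funext j
  by_cases h : IsRep G j
  · rw [extG_apply_of_isRep G _ h]
    have hj : j ∈ G.part j := G.mem_part_self.2 (mem_univ j)
    have := hu j
    rw [← Finset.add_sum_erase _ _ hj] at this
    have hrest : ∀ i ∈ (G.part j).erase j, liftFree G (fun i : Free G ↦ u i) i = u i := by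
      intro i hi
      obtain ⟨hne, hi⟩ := Finset.mem_erase.1 hi
      have hnot : ¬IsRep G i := fun h' ↦ hne (by rw [eq_rep_of_isRep_of_mem G h' hi, h])
      rw [liftFree_apply_of_not_isRep G _ hnot]
    rw [Finset.sum_congr rfl hrest]
    linarith
  · rw [extG_apply_of_not_isRep G _ h]

/-- `extG` is continuous (it is linear). [folklore] -/
theorem continuous_extG : Continuous (extG G) := by
  refine continuous_pi fun j ↦ ?_
  by_cases h : IsRep G j
  · simp only [extG, h, ↓reduceIte]
    refine (continuous_finsetSum _ fun i _ ↦ ?_).neg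
    by_cases hi : IsRep G i
    · simp only [liftFree, hi, ↓reduceDIte]
      exact continuous_const
    · simp only [liftFree, hi, ↓reduceDIte]
      exact continuous_apply _
  · simp only [extG, h, ↓reduceIte, liftFree, ↓reduceDIte]
    exact continuous_apply _

/-- `extG` is measurable. [folklore] -/
theorem measurable_extG : Measurable (extG G) := (continuous_extG G).measurable

end RudnickSarnak

end Literature.NumberTheory.LFunctions

end
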